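import Literature.Analysis.FluidPDE.OnsagerCCFSFlux
import Literature.Analysis.FunctionSpaces.TorusCommutatorEstimate
import HarnessLib

/-!
# Sharp Onsager rigidity (CCFS 2008, Thm 3.3): the flux estimate and the vanishing of the flux — discharge of F₂ and F₃

Sorry-free proofs of the named facts `Literature.Analysis.FluidPDE.Torus.abs_cetFlux_le_eLocDiffModulus` (F₂) and
`Literature.Analysis.FluidPDE.Torus.tendsto_lintegral_cetFlux` (F₃) of `Literature/Analysis/FluidPDE/OnsagerCCFSFlux`,
i.e. of Cheskidov–Constantin–Friedlander–Shvydkoy 2008, §3.2, Prop. 3.2 (in the local form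
`|Π| ≤ C ω³`) and of Thm 3.3 (first sentence, through the `limsup` estimate stated after
Prop. 3.2), in the tree's mollifier transcription on `T^d`.

## F₂ from the tree's Constantin–E–Titi estimate

The analytic work — the CET decomposition `(uᵢuⱼ)^ε = rᵢⱼ - (uᵢ - uᵢ^ε)(uⱼ - uⱼ^ε) + uᵢ^ε uⱼ^ε`,
the divergence-free cancellation and the two Hölder bounds — is the tree's
`Torus.abs_integral_flux_vecMollify_le` (`FunctionSpaces/TorusCommutatorEstimate`,
Constantin–E–Titi 1994, (9)–(11); this is exactly the argument "following [cet]" printed in the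
proof of CCFS Prop. 3.2): for `u ∈ L³` weakly divergence free and a bound `A` on the `L³`
translation modulus of `u` at scale `ε`,
`|∫ ∑ᵢⱼ ((uᵢuⱼ) ⋆ K_ε) ∂ⱼuᵢ^ε| ≤ (#d)² · 2A² · (C₁/ε) A`.
Here (`Torus.abs_cetFlux_le_eLocDiffModulus_holds`):
* the flux `Π_{K_ε}[v] = Torus.cetFlux (kernel ε) v` of `OnsagerCCFSFlux` *is* that integral
  (`Torus.cetFlux_kernel_eq_integral_flux_vecMollify`: `Torus.vecConv v (kernel ε)` and
  `Torus.vecMollify ε v` agree definitionally, and the double sum is symmetrised);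
* the translation modulus at scale `ε` is at most `A = ω(v; ε) ε^{1/3}` with the local
  difference modulus `ω(v; ε) = eLocDiffModulus (1/3) 3 v volume ε`
  (`Torus.eLpNorm_shift_sub_le`);
* `(ω ε^{1/3})³ (C₁/ε) = C₁ ω³`, so `|Π_{K_ε}[v]| ≤ 2 (#d)² C₁ ω(v; ε)³`, `C₁ = Torus.gradProfileMass d`
  (if `ω = ∞` there is nothing to prove; the constant offered is `2 (#d)² C₁ + 1`).

## The vanishing (F₃)

`Torus.tendsto_lintegral_cetFlux_holds`: dominated convergence for the lower Lebesgue integral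
along `𝓝[>] 0` (Mathlib's `tendsto_lintegral_filter_of_dominated_convergence'`, whose bound need
not be measurable — the Besov seminorm is not known to be measurable in time) with the bound
`C [u(t)]³_{B^{1/3}_{3,∞}}` (`Torus.lintegral_eBesovSupSeminorm_pow_three_lt_top`), the pointwise
limit coming from F₂ and `MemBesovSupVanishing.tendsto_eLocDiffModulus`; measurability of
`t ↦ Π_{K_ε}[u(t)]` is `Torus.aestronglyMeasurable_cetFlux` (Fubini).

## Relation to the tree

Nothing is restated: F₂ is reduced to `TorusCommutatorEstimate` (sibling route
`Literature.Analysis.FluidPDE.onsager_rigidity`, Constantin–E–Titi form), whose Hölder exponent lemmas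
(`Literature.Analysis.FunctionSpaces.holderTriple_three_three`, `Literature.Analysis.FunctionSpaces.holderTriple_threeHalves_three`) are also the ones used
downstream (`OnsagerCCFSTestField`); `Torus.isDivFree_vecConv` is the `vecConv` spelling of
`Torus.isDivFree_vecMollify`, kept because the F₁ file refers to it.

## Mathlib search

Mathlib (this pin) has dominated convergence for `lintegral` along filters
(`MeasureTheory.tendsto_lintegral_filter_of_dominated_convergence'`), parametrised
measurability of integrals (`MeasureTheory.AEStronglyMeasurable.integral_prod_right'`) and the
`ℝ≥0∞` algebra used; it has no commutator/flux estimate of Constantin–E–Titi type (searched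
`convolution` with `sub`/`commutator`, `Besov`) — that is the tree's `TorusCommutatorEstimate`.

## References

* A. Cheskidov, P. Constantin, S. Friedlander, R. Shvydkoy, *Energy conservation and Onsager's
  conjecture for the Euler equations*, Nonlinearity 21 (2008) = arXiv:0704.0759, §3.2,
  Prop. 3.2, (13), Thm 3.3.
* P. Constantin, W. E, E. S. Titi, *Onsager's conjecture on the energy conservation for solutions
  of Euler's equation*, Comm. Math. Phys. 165 (1994), 207–209, (9)–(11).
-/

noncomputable section

open MeasureTheory TopologicalSpace Set Function Filter Topology Metric
open scoped ENNReal NNReal Convolution ContDiff InnerProductSpace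

namespace Literature.Analysis.FluidPDE

namespace Torus

variable {d : Type*} [Fintype d] [DecidableEq d]

/-! ## F₂: the Constantin–E–Titi estimate in local form -/

section FluxEstimate

omit [DecidableEq d] in
/-- **Translation estimate from the local modulus**: for `‖y‖ ≤ ε`,
`‖v(· - y) - v‖_{L³} ≤ ω(v; ε) ε^{1/3}` (the defining inequality of `eLocDiffModulus` at the
increment `-y`, and `‖y‖^{1/3} ≤ ε^{1/3}`; trivial for `y = 0`). [folklore] -/
theorem eLpNorm_shift_sub_le {F' : Type*} [NormedAddCommGroup F'] (v : UnitAddTorus d → F')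
    {ε : ℝ} {y : UnitAddTorus d} (hy : ‖y‖ ≤ ε) :
    eLpNorm (fun x => v (x - y) - v x) 3 volume ≤
      eLocDiffModulus (1 / 3) 3 v volume ε * ENNReal.ofReal (ε ^ (1 / 3 : ℝ)) := by
  by_cases hy0 : y = 0
  · subst hy0
    simp
  · have hh : -y ≠ 0 := neg_ne_zero.2 hy0
    have hnorm : ‖-y‖ ≤ ε := by rwa [norm_neg]
    have h := eLpNorm_sub_le_eLocDiffModulus_mul (s := 1 / 3) (p := 3) (f := v) (μ := volume) hh hnorm
    simp_rw [← sub_eq_add_neg] at h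
    refine h.trans (mul_le_mul_right (ENNReal.ofReal_le_ofReal ?_) _)
    rw [norm_neg]
    exact Real.rpow_le_rpow (norm_nonneg _) hy (by norm_num)

omit [DecidableEq d] in
/-- `Torus.vecConv v (kernel ε)` (`OnsagerCCFSFlux`) is `Torus.vecMollify ε v`
(`TorusMollifiedFields`), definitionally. [folklore] -/
theorem vecConv_kernel_eq_vecMollify (v : UnitAddTorus d → EuclideanSpace ℝ d) (ε : ℝ) :
    vecConv v (FunctionSpaces.Torus.kernel ε) = FunctionSpaces.Torus.vecMollify ε v := rfl

/-- **The flux of `OnsagerCCFSFlux` is the flux integral of `TorusCommutatorEstimate`**: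
`Π_{K_ε}[v] = ∫ ∑ᵢⱼ ((vᵢvⱼ) ⋆ K_ε) ∂ⱼ(v^ε)ᵢ` (exchange the two sums and use `vᵢvⱼ = vⱼvᵢ`). [folklore] -/
theorem cetFlux_kernel_eq_integral_flux_vecMollify (ε : ℝ) (v : UnitAddTorus d → EuclideanSpace ℝ d) :
    cetFlux (FunctionSpaces.Torus.kernel ε) v = ∫ x, ∑ i, ∑ j, ((fun y => v y i * v y j) ⋆ FunctionSpaces.Torus.kernel ε) x *
      FunctionSpaces.Torus.partialDeriv j (fun y => FunctionSpaces.Torus.vecMollify ε v y i) x := by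
  unfold cetFlux
  refine integral_congr_ae (Eventually.of_forall fun x => ?_)
  dsimp only
  rw [Finset.sum_comm]
  refine Finset.sum_congr rfl fun a _ => Finset.sum_congr rfl fun b _ => ?_
  rw [show (fun y => v y b * v y a) = fun y => v y a * v y b from funext fun y => mul_comm _ _]
  rfl

/-- `(ω ε^{1/3})³ (C₁/ε) = C₁ ω³` in `ℝ`: the scale algebra of the CET estimate. [folklore] -/
theorem cet_scale_identity_real {ε : ℝ} (hε : 0 < ε) (w C₁ : ℝ) :
    (w * ε ^ (1 / 3 : ℝ)) * (w * ε ^ (1 / 3 : ℝ)) * (ε⁻¹ * C₁ * (w * ε ^ (1 / 3 : ℝ))) =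
      C₁ * w ^ 3 := by
  have h3 : (ε ^ (1 / 3 : ℝ)) ^ 3 = ε := by
    rw [← Real.rpow_natCast, ← Real.rpow_mul hε.le]
    norm_num
  have h1 : ε⁻¹ * (ε ^ (1 / 3 : ℝ)) ^ 3 = 1 := by
    rw [h3, inv_mul_cancel₀ hε.ne']
  calc (w * ε ^ (1 / 3 : ℝ)) * (w * ε ^ (1 / 3 : ℝ)) * (ε⁻¹ * C₁ * (w * ε ^ (1 / 3 : ℝ)))
      = C₁ * w ^ 3 * (ε⁻¹ * (ε ^ (1 / 3 : ℝ)) ^ 3) := by ring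
    _ = C₁ * w ^ 3 := by rw [h1, mul_one]

/-- **Discharge of `abs_cetFlux_le_eLocDiffModulus`** — the Constantin–E–Titi flux estimate in
local form (CCFS 2008, Prop. 3.2 and its proof, mollifier transcription): with
`C = 2 (#d)² C₁ + 1`, `C₁ = Torus.gradProfileMass d` the gradient mass of the fixed profile, every
`v ∈ L³(T^d; ℝ^d)` weakly divergence free satisfies `|Π_{K_ε}[v]| ≤ C ω(v; ε)³` for
`0 < ε ≤ 1/4`. Reduction to `Torus.abs_integral_flux_vecMollify_le` with the translation bound
`A = ω(v; ε) ε^{1/3}`. [cite: CCFS2008, §3.2, Prop. 3.2] -/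
theorem abs_cetFlux_le_eLocDiffModulus_holds : abs_cetFlux_le_eLocDiffModulus (d := d) := by
  refine ⟨(2 * (Fintype.card d : ℝ) ^ 2 * FunctionSpaces.Torus.gradProfileMass d).toNNReal + 1, ?_⟩
  intro v hv hdiv ε hε hε'
  set om : ℝ≥0∞ := eLocDiffModulus (1 / 3) 3 v volume ε with hom
  have hCne : (((2 * (Fintype.card d : ℝ) ^ 2 * FunctionSpaces.Torus.gradProfileMass d).toNNReal + 1 : ℝ≥0) : ℝ≥0∞) ≠ 0 :=
    ENNReal.coe_ne_zero.2 (ne_of_gt (add_pos_of_nonneg_of_pos zero_le one_pos))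
  by_cases homt : om = ⊤
  · rw [homt, ENNReal.top_pow three_ne_zero, ENNReal.mul_top hCne]
    exact le_top
  -- the translation bound `A = om ε^{1/3}`
  set A : ℝ≥0∞ := om * ENNReal.ofReal (ε ^ (1 / 3 : ℝ)) with hA
  have hAt : A ≠ ⊤ := ENNReal.mul_ne_top homt ENNReal.ofReal_ne_top
  have hAy : ∀ y : UnitAddTorus d, ‖y‖ ≤ ε → eLpNorm (fun x => v (x - y) - v x) 3 volume ≤ A :=
    fun y hy => eLpNorm_shift_sub_le v hy
  have h := FunctionSpaces.Torus.abs_integral_flux_vecMollify_le hv hdiv hε hε' hAt hAy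
  rw [← cetFlux_kernel_eq_integral_flux_vecMollify] at h
  -- rewrite the right-hand side as `2 (#d)² C₁ om³`
  have hAr : A.toReal = om.toReal * ε ^ (1 / 3 : ℝ) := by
    rw [hA, ENNReal.toReal_mul, ENNReal.toReal_ofReal (Real.rpow_nonneg hε.le _)]
  have hR : (Fintype.card d : ℝ) ^ 2 *
      (2 * A.toReal * A.toReal * ((ε⁻¹ * FunctionSpaces.Torus.gradProfileMass d) * A.toReal)) =
      (2 * (Fintype.card d : ℝ) ^ 2 * FunctionSpaces.Torus.gradProfileMass d) * om.toReal ^ 3 := by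
    rw [hAr]
    have := cet_scale_identity_real hε om.toReal (FunctionSpaces.Torus.gradProfileMass d)
    calc (Fintype.card d : ℝ) ^ 2 * (2 * (om.toReal * ε ^ (1 / 3 : ℝ)) * (om.toReal * ε ^ (1 / 3 : ℝ)) *
          (ε⁻¹ * FunctionSpaces.Torus.gradProfileMass d * (om.toReal * ε ^ (1 / 3 : ℝ))))
        = 2 * (Fintype.card d : ℝ) ^ 2 * ((om.toReal * ε ^ (1 / 3 : ℝ)) *
            (om.toReal * ε ^ (1 / 3 : ℝ)) * (ε⁻¹ * FunctionSpaces.Torus.gradProfileMass d * (om.toReal * ε ^ (1 / 3 : ℝ)))) := by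
          ring
      _ = 2 * (Fintype.card d : ℝ) ^ 2 * (FunctionSpaces.Torus.gradProfileMass d * om.toReal ^ 3) := by rw [this]
      _ = (2 * (Fintype.card d : ℝ) ^ 2 * FunctionSpaces.Torus.gradProfileMass d) * om.toReal ^ 3 := by ring
  rw [hR] at h
  -- pass to `ℝ≥0∞`
  have hC0 : 0 ≤ 2 * (Fintype.card d : ℝ) ^ 2 * FunctionSpaces.Torus.gradProfileMass d := by
    have := FunctionSpaces.Torus.gradProfileMass_nonneg (d := d)
    positivity
  have h2 : ENNReal.ofReal |cetFlux (FunctionSpaces.Torus.kernel ε) v| ≤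
      ((2 * (Fintype.card d : ℝ) ^ 2 * FunctionSpaces.Torus.gradProfileMass d).toNNReal : ℝ≥0∞) * om ^ 3 := by
    refine (ENNReal.ofReal_le_ofReal h).trans (le_of_eq ?_)
    rw [ENNReal.ofReal_mul hC0, ENNReal.ofReal_pow ENNReal.toReal_nonneg, ENNReal.ofReal_toReal homt]
    rfl
  exact h2.trans (mul_le_mul' (ENNReal.coe_le_coe.2 le_self_add) le_rfl)

/-- **Mollification of a weakly divergence-free field is divergence free**, `vecConv` spelling of
the tree's `Torus.isDivFree_vecMollify` (`TorusCommutatorEstimate`: test the weak divergence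
condition with `K_ε(x - ·)`). [folklore] -/
theorem isDivFree_vecConv {v : UnitAddTorus d → EuclideanSpace ℝ d} (hv : Integrable v volume)
    (hdiv : FunctionSpaces.Torus.IsWeaklyDivFree v) {ε : ℝ} (hε : 0 < ε) (hε' : ε ≤ 1 / 4) :
    FunctionSpaces.Torus.IsDivFree (vecConv v (FunctionSpaces.Torus.kernel ε)) := by
  rw [vecConv_kernel_eq_vecMollify]
  exact FunctionSpaces.Torus.isDivFree_vecMollify hv hdiv hε hε'

end FluxEstimate

/-! ## F₃: the total flux vanishes in the CCFS class -/

section FluxVanishing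

variable {F' : Type*} [NormedAddCommGroup F']

omit [DecidableEq d] in
/-- **`L³_t B^s_{3,∞}`: the cubed Besov seminorm has finite time integral.** Only lower
Lebesgue integrals and a.e. inequalities are used (no measurability of the seminorm in time). [folklore] -/
theorem lintegral_eBesovSupSeminorm_pow_three_lt_top {G : Type*} [NormedAddCommGroup G]
    [MeasurableSpace G] {μ : Measure G} {s : ℝ} {S : Set ℝ} {u : ℝ → G → F'}
    (hB : FunctionSpaces.MemLpBesovSup 3 s 3 u μ S) :
    ∫⁻ t in S, FunctionSpaces.eBesovSupSeminorm s 3 (u t) μ ^ 3 < ⊤ := by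
  have h3 : ((3 : ℝ≥0∞)).toReal = 3 := by norm_num
  have h2 : ∫⁻ t in S, ‖(FunctionSpaces.eBesovSupNorm s 3 (u t) μ).toReal‖ₑ ^ (3 : ℝ) < ⊤ := by
    have := lintegral_rpow_enorm_lt_top_of_eLpNorm_lt_top (by norm_num) (by norm_num) hB.2
    rwa [h3] at this
  refine lt_of_le_of_lt (lintegral_mono_ae ?_) h2
  filter_upwards [hB.1] with t ht
  have hfin : FunctionSpaces.eBesovSupNorm s 3 (u t) μ ≠ ⊤ := ht.eBesovSupNorm_lt_top.ne
  rw [Real.enorm_eq_ofReal ENNReal.toReal_nonneg, ENNReal.ofReal_toReal hfin,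
    show (3 : ℝ) = ((3 : ℕ) : ℝ) by norm_num, ENNReal.rpow_natCast]
  exact pow_le_pow_left' le_add_self 3

/-- **Measurability in time of the flux.** For `u` jointly measurable on `S × T^d` with
`u(t) ∈ L¹` for a.e. `t ∈ S`, `t ↦ Π_K[u(t)]` is a.e.-strongly measurable on `S` for smooth `K`
(Fubini; at the a.e. times where `u(t) ∈ L¹`, `∂ᵢ(uⱼ ⋆ K) = uⱼ ⋆ ∂ᵢK` is a parametrised
convolution). [folklore] -/
theorem aestronglyMeasurable_cetFlux {S : Set ℝ} {u : ℝ → UnitAddTorus d → EuclideanSpace ℝ d}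
    (hm : AEStronglyMeasurable (uncurry u) ((volume.restrict S).prod volume))
    (h1 : ∀ᵐ t ∂(volume.restrict S), Integrable (u t) volume) {K : UnitAddTorus d → ℝ}
    (hK : FunctionSpaces.Torus.IsSmooth K) :
    AEStronglyMeasurable (fun t => cetFlux K (u t)) (volume.restrict S) := by
  have hKc : Continuous K := hK.continuous
  -- the measurable model of the integrand
  set Φ : ℝ → UnitAddTorus d → ℝ := fun t x =>
    ∑ i, ∑ j, ((fun y => u t y i * u t y j) ⋆ K) x * ((fun y => u t y j) ⋆ FunctionSpaces.Torus.partialDeriv i K) x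
    with hΦ
  have hA : ∀ i j, AEStronglyMeasurable (uncurry fun t x => ((fun y => u t y i * u t y j) ⋆ K) x)
      ((volume.restrict S).prod volume) := fun i j =>
    FunctionSpaces.Torus.aestronglyMeasurable_uncurry_convolution (ContinuousLinearMap.lsmul ℝ ℝ)
      ((aestronglyMeasurable_uncurry_apply hm i).mul (aestronglyMeasurable_uncurry_apply hm j)) hKc
  have hB : ∀ i j, AEStronglyMeasurable (uncurry fun t x => ((fun y => u t y j) ⋆ FunctionSpaces.Torus.partialDeriv i K) x)
      ((volume.restrict S).prod volume) := fun i j =>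
    FunctionSpaces.Torus.aestronglyMeasurable_uncurry_convolution (ContinuousLinearMap.lsmul ℝ ℝ)
      (aestronglyMeasurable_uncurry_apply hm j) (hK.partialDeriv i).continuous
  have hΦm : AEStronglyMeasurable (uncurry Φ) ((volume.restrict S).prod volume) := by
    show AEStronglyMeasurable (fun p : ℝ × UnitAddTorus d => ∑ i, ∑ j,
      ((fun y => u p.1 y i * u p.1 y j) ⋆ K) p.2 * ((fun y => u p.1 y j) ⋆ FunctionSpaces.Torus.partialDeriv i K) p.2) _
    refine Finset.aestronglyMeasurable_fun_sum _ fun i _ =>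
      Finset.aestronglyMeasurable_fun_sum _ fun j _ => ?_
    exact (hA i j).mul (hB i j)
  have hΦint : AEStronglyMeasurable (fun t => ∫ x, Φ t x) (volume.restrict S) :=
    hΦm.integral_prod_right'
  refine hΦint.congr ?_
  filter_upwards [h1] with t ht
  simp only [hΦ, cetFlux]
  refine integral_congr_ae (Eventually.of_forall fun x => ?_)
  refine Finset.sum_congr rfl fun i _ => Finset.sum_congr rfl fun j _ => ?_
  rw [FunctionSpaces.Torus.partialDeriv_convolution (ht.eval_piLp j) hK]

/-- **Discharge of `tendsto_lintegral_cetFlux`** (CCFS 2008, Thm 3.3, first sentence, through the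
`limsup` estimate stated after Prop. 3.2): in the class
`L³_t B^{1/3}_{3,c₀}` the time-integrated flux through the mollifier scale `ε` tends to `0`.
Proof: dominated convergence for the lower Lebesgue integral along `𝓝[>] 0`
(Mathlib's `tendsto_lintegral_filter_of_dominated_convergence'`, which tolerates the possibly
non-measurable bound `C [u(t)]³_{B^{1/3}_{3,∞}}`, of finite lower integral by
`lintegral_eBesovSupSeminorm_pow_three_lt_top`): at a.e. time `|Π_{K_ε}[u(t)]| ≤ C ω(u(t); ε)³`
(`abs_cetFlux_le_eLocDiffModulus_holds`) with `ω(u(t); ε) → 0`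
(`MemBesovSupVanishing.tendsto_eLocDiffModulus`) and `ω ≤ [u(t)]_{B^{1/3}_{3,∞}}`. [cite: CCFS2008, Thm 3.3] -/
theorem tendsto_lintegral_cetFlux_holds : tendsto_lintegral_cetFlux (d := d) := by
  intro T u hm hdiv hB
  obtain ⟨C, hC⟩ := abs_cetFlux_le_eLocDiffModulus_holds (d := d)
  have hm' : AEStronglyMeasurable (uncurry u) ((volume.restrict (Ioo 0 T)).prod volume) :=
    aestronglyMeasurable_uncurry_restrict_prod_of_stLift hm
  have hL3 : ∀ᵐ t ∂(volume.restrict (Ioo 0 T)), MemLp (u t) 3 volume :=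
    hB.1.mono fun t ht => ht.memBesovSup.memLp
  have hL1 : ∀ᵐ t ∂(volume.restrict (Ioo 0 T)), Integrable (u t) volume :=
    hL3.mono fun t ht => ht.integrable (by norm_num)
  have hsmall : ∀ᶠ ε in 𝓝[>] (0 : ℝ), 0 < ε ∧ ε ≤ 1 / 4 := by
    filter_upwards [Ioc_mem_nhdsGT (show (0 : ℝ) < 1 / 4 by norm_num)] with ε hε
    exact ⟨hε.1, hε.2⟩
  set bound : ℝ → ℝ≥0∞ := fun t => C * FunctionSpaces.eBesovSupSeminorm (1 / 3) 3 (u t) volume ^ 3 with hbound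
  have h := tendsto_lintegral_filter_of_dominated_convergence' (μ := volume.restrict (Ioo 0 T))
    (l := 𝓝[>] (0 : ℝ)) (F := fun ε t => ‖cetFlux (FunctionSpaces.Torus.kernel ε) (u t)‖ₑ) (f := fun _ => 0) bound
    ?_ ?_ ?_ ?_
  · simpa only [lintegral_zero] using h
  · filter_upwards [hsmall] with ε hε
    exact (aestronglyMeasurable_cetFlux hm' hL1 (FunctionSpaces.Torus.isSmooth_kernel hε.1 hε.2)).enorm
  · filter_upwards [hsmall] with ε hε
    filter_upwards [hL3, hdiv] with t ht htdiv
    rw [Real.enorm_eq_ofReal_abs]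
    refine (hC ht htdiv hε.1 hε.2).trans ?_
    exact mul_le_mul_right (pow_le_pow_left' (eLocDiffModulus_le_eBesovSupSeminorm ε) 3) _
  · rw [hbound, lintegral_const_mul' _ _ ENNReal.coe_ne_top]
    exact ENNReal.mul_ne_top ENNReal.coe_ne_top
      (lintegral_eBesovSupSeminorm_pow_three_lt_top hB.memLpBesovSup).ne
  · filter_upwards [hL3, hdiv, hB.1] with t ht htdiv htB
    have hω : Tendsto (fun ε => (C : ℝ≥0∞) * eLocDiffModulus (1 / 3) 3 (u t) volume ε ^ 3)
        (𝓝[>] 0) (𝓝 0) := by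
      have h0 := htB.tendsto_eLocDiffModulus
      have h1 : Tendsto (fun ε => eLocDiffModulus (1 / 3) 3 (u t) volume ε ^ 3) (𝓝[>] 0) (𝓝 0) := by
        have := ((ENNReal.continuous_pow 3).tendsto 0).comp h0
        rw [zero_pow three_ne_zero] at this
        exact this
      have h2 := ENNReal.Tendsto.const_mul h1 (Or.inr ENNReal.coe_ne_top) (a := (C : ℝ≥0∞))
      rwa [mul_zero] at h2
    refine tendsto_of_tendsto_of_tendsto_of_le_of_le' tendsto_const_nhds hω
      (Eventually.of_forall fun ε => bot_le) ?_
    filter_upwards [hsmall] with ε hε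
    rw [Real.enorm_eq_ofReal_abs]
    exact hC ht htdiv hε.1 hε.2

end FluxVanishing

end Torus

end Literature.Analysis.FluidPDE
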